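import Summits.HodgeConjecture.HodgeConjecture.Theses.HeckePrymWeil
import Summits.HodgeConjecture.HodgeConjecture.Theses.AnchorTransport
import Literature.AlgebraicGeometry.Motives.AbelianVarietyProjectiveChart
import Literature.AlgebraicGeometry.HodgeTheory.LefschetzOneOne
import Literature.AlgebraicGeometry.HodgeTheory.FermatHypersurfaceReduction
import Literature.AlgebraicGeometry.HodgeTheory.ComplexConjugation
import Literature.AlgebraicGeometry.HodgeTheory.MotivatedClasses
import Literature.AlgebraicGeometry.Motives.AlgPointsProductProofs
import Literature.AlgebraicGeometry.Motives.CurveNet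
import Literature.AlgebraicGeometry.HodgeTheory.HodgeLocus
import Literature.NumberTheory.Transcendental.AnalytificationSeparatedProofs
import Literature.AlgebraicTopology.SingularHomology.CohomologyOfPoint

/-!
# Disproof attempts on crux `WeilVariationalHodge` (stmt-HodgeConjecture-14497, route HeckePrymWeil) — findings

Standing-adversary work file (cdisprove seat `refuter-cdisprove-stmt-HodgeConjecture-14497-0`, cycle 1,
2026-08-16). Everything below is `lean check`ed: rc 0, NO `sorry` (near-misses are recorded as named
`Prop`s with the paper argument in the docstring, §5, never as sorried theorems). Earlier one-shot refuter
passes on this item (refute-pool-g48-5, rattack-14497-0; item notes) found the HC-sandwich, the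
specialisation from `AnchorTransport.VariationalHodge` and the `M = 1` rung; this file re-proves those in
§1/§3 for self-containedness and ADDS §2 (the sharp pointwise upper bound `SectorHC` with the iso-transport
actually carried out, and the HC-free bound through the Lefschetz standard conjecture `B` + André 1996),
§3 (`M = 0`, `M = 2`, all-`p`, `Stripped`), §4–§5 (junk / load census) and the LANDED negative lemma file
`Theorems/WeilVariationalHodge/Negative/DominatedByHodge.lean` (= §1–§2 in negative form).

## The statement (re-read by `Iff.rfl`, §0)

`WeilVariationalHodge := ∀ p prime, p % 4 = 3, 7 ≤ p, ∀ M ≥ 1, Rung p M`, where `Rung p M` (§0) says: for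
every smooth projective family `f : 𝒳 ⟶ S` of relative dimension `2M` (`IsSmoothProjectiveFamily`:
`SmoothOfRelativeDimension (2M) f.left ∧ IsProper f.left ∧ ∀ s, IsSmoothProjective (2M) (fiberOver f s)` —
REAL Mathlib/tree definitions, `fiberOver f s = 𝒳 ×_S Spec ℂ`) over an irreducible base with smooth
structure map, every global class `W ∈ H^{2M}(𝒳(ℂ); ℂ)` which is fibrewise rational of type `(M,M)`
(`FibrewiseRationalHodge`), every fibre being `ℂ`-isomorphic to an abelian `2M`-fold `A'` carrying
`φ' ≫ φ' = -(p • 𝟙)` (`WeilFibres`; `AbelianVariety ℂ` is a REAL structure: proper geometrically-integral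
group scheme over `Spec ℂ`, `dim = schemeDim`), and `W|_{𝒳_{s₀}} ∈ N^M H^{2M}` for ONE `s₀`: then
`W|_{𝒳_s} ∈ algebraicClasses (fiberOver f s) M = N^M H^{2M}(𝒳_s(ℂ); ℂ)` for EVERY `s`. No junk operators
(no `/`, ℕ-subtraction only in `p - 1`-free positions, no `sSup`/`tsum`); degree indices `2M/2M/M/M`
consistent with `HodgeConjectureFor (2M)`.

## Verdict so far: NO KILL — and none is possible short of a counterexample to the Hodge conjecture

1. (§1) `weilVariationalHodge_of_hodgeConjecture : HodgeConjecture → WeilVariationalHodge` in two lines,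
   using ONLY `IsSmoothProjectiveFamily.isSmoothProjective s` and the fibrewise rational-`(M,M)` hypothesis
   AT `s`; irreducibility, smoothness of `S`, the Weil fibres, the prime `p`, `M ≥ 1` and the anchor `s₀`
   are all unused. Hence `not_hodgeConjecture_of_not_weilVariationalHodge`: ANY refutation of the crux —
   junk-based or genuine — is a refutation of the summit `HodgeConjecture` AS TYPED (Charles–Schnell,
   arXiv:1101.3647 Cor. 35 = book Cor. 11.3.6 "The Hodge conjecture implies the variational Hodge
   conjecture", here even without the global invariant cycle theorem because the crux ASSUMES `(M,M)` at
   every fibre). Also `weilVariationalHodge_of_variationalHodge`: the crux is the Weil-fibre instance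
   (`n := 2M, p := M`) of route AnchorTransport's crux `VariationalHodge` (stmt-1076), so a kill propagates
   there (`not_variationalHodge_of_not_weilVariationalHodge`); both routes share `IsoInvariance` verbatim.
2. (§2) SHARP POINTWISE BOUND. `rung_of_sectorHC : SectorHC p M → Rung p M`, where `SectorHC p M` = "every
   rational `(M,M)` class on every abelian `2M`-fold with `φ ≫ φ = -p` is algebraic" (ALL Hodge classes of
   such abelian varieties — not only the Weil eigen-span of the route's rung predicate `HWA(p, M)`). The
   transport along the given iso `e : A'.X ≅ 𝒳_s` is carried out with the tree's PROVED
   `IsRationalClass.map`, `IsOfHodgeType.map_of_iso`, `mem_algebraicClasses_map_of_iso`,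
   `map_hom_map_inv_apply`. READING FOR THE PLANNER: the crux is weaker than pointwise HC on its own fibres
   and its ONLY extra content is the word "transport" (irreducible base + anchor); conversely (§5,
   KERNEL-CHECKED: `rungWithoutIrreducible_iff_sectorHC`) with `IrreducibleSpace S.left` (and the
   paper-removable `Smooth S.hom`) dropped the rung IS `SectorHC` — tested on the constant family
   `A × Spec (ℂ × ℂ) → Spec (ℂ × ℂ)` with the class `c` on one sheet and `0` on the other. HC-FREE BOUND:
   `sectorHC_of_standardConjectureB`: the Lefschetz standard conjecture `B` for all smooth projective
   complex varieties implies every `SectorHC p M`, granted André's printed theorems (tree named facts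
   `Andre1996_hodgeClasses_abelianVariety_motivated` = Thm. 0.6.2 and
   `Andre1996_motivatedClasses_le_algebraicClasses_of_standardConjectureB` = §2.1); so a kill of the crux
   also refutes `B` modulo print (`consequences_of_not_weilVariationalHodge`; Charles–Schnell after Thm. 36:
   "the standard conjectures imply the variational Hodge conjecture, see [An]"). The barrier
   `Literature.Barriers.HodgeConjecture.Andre1996_hodgeClassesOnAbelianVarieties_motivated` therefore
   APPLIES squarely to this seat: no refutation without ¬B.
3. (§3) LOAD-BEARING CENSUS — for TRUTH nothing is load-bearing except the three data HC consumes (fibre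
   smooth projective, `W|_s` rational, `W|_s` of type `(M,M)`); consequently NO `_false_without_<H>` theorem
   exists for this crux (every weakening is still a consequence of HC; a witness against any of them is a
   Hodge counterexample). Kernel-checked: `rung_zero` (`M = 0` TRUE outright by `algebraicClasses_zero`, so
   `1 ≤ M` is decoration: `weilVariationalHodge_iff_withZero`); `rung_all_p_of_hodgeConjecture` (the
   `p`-conditions are decoration modulo HC); `Stripped` (no irreducibility, no smooth base, no Weil fibres,
   no anchor, all `p, M`) with `HodgeConjecture → Stripped → WeilVariationalHodge`. KNOWN RUNGS in print,
   kernel-checked modulo the printed theorem: `M = 1` from Lefschetz `(1,1)` (`rung_one_of_lefschetz`, tree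
   fact `lefschetzOneOne_rational`, Voisin I Thm. 11.30) and `M = 2` from "the Hodge conjecture holds for
   abelian fourfolds" (`rung_two_of_hodgeConjecture_abelianFourfolds`, Markman arXiv:2502.03415 Cor. 1.6.1,
   READ: p. 7 of the held text, spelled exactly as in the tree's `WeilClassesFourfoldsProofs`). First open
   rung: `M = 3` (sixfold fibres; for `p = 7` off discriminant `-1`, WeilLocusSixfolds2026 §1), and there
   the crux asks for MORE than Weil classes (all `(3,3)` classes of the fibres).
   For the intended PROOF (not truth) the census is the opposite: `IrreducibleSpace S.left` and the anchor
   are everything (§5, kernel-checked: dropping irreducibility collapses the crux onto `SectorHC`, i.e. onto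
   pointwise HC for ALL Hodge classes of the sector's abelian varieties), `Smooth S.hom` is removable on paper (pull back to a resolution of `S`), fibrewise
   rationality/Hodge type at all `s` follow from `s₀` by the theorem of the fixed part (Deligne Hodge II
   4.1.1; Charles–Schnell Prop. 34) once `S` is a variety, and quasi-compactness/separatedness of `S` (NOT
   assumed by the crux) are harmless (any two complex points lie in a common irreducible quasi-compact open;
   chain through affine opens). NOTE for provers: the tree's `Andre1996_deformation` (Thm. 0.5, motivated
   transport) wants `QuasiCompact S.hom`, `LocallyOfFiniteType`, reducedness and a projective embedding of
   `f` over `S` — none is a field of the crux; smooth ⇒ reduced + lft, irreducible ⇒ connected, and over a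
   normal quasi-compact base abelian schemes are projective (Raynaud 1970 XI 1.4), so the gap is bookkeeping.
4. (§4) JUNK / SMALL MODELS: none. The conclusion lives on a fibre that is a smooth projective variety
   isomorphic to an abelian variety, with the summit's own carriers (`complexBetti`, `IsRationalClass`,
   `IsOfHodgeType` = ∃ Hodge model, `algebraicClasses = N^M H^{2M}` via `Order.coheight` in Mathlib's
   specialization preorder on `Scheme`, closed points minimal); by item 1 any junk exploitable here is junk
   in the audited summit statement. Non-separated / non-quasi-compact `S` (allowed: only `Smooth S.hom` and
   `IrreducibleSpace`) give no handle (item 3). The hypotheses are satisfiable on paper (constant family of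
   a Weil-type `A` over `Spec ℂ`; PEL families of unitary type) but NOT in the tree: no `AbelianVariety ℂ` of
   positive dimension is constructible today (only `Spec ℂ`, `dim 0`, excluded by `A'.dim = 2M ≥ 2`), so the
   crux is unfalsifiable in Lean for a second, practical reason; the construction burden sits with
   `HeckePrymAnchors` (stmt-14496, an `∃`-statement), not here.
5. (§5) IRREDUCIBILITY IS THE WHOLE CONTENT — kernel-checked, no near-miss left:
   `rungWithoutIrreducible_iff_sectorHC : RungWithoutIrreducible p M ↔ SectorHC p M` for all `p, M`. The
   hard direction builds (§5b, namespace `TwoPoint`) the two-point base `S₂ = Spec (ℂ × ℂ)` (its complex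
   points are exactly `p₀, p₁`: `pt_cases`, `p₀_ne_p₁`; finite + Hausdorff ⇒ discrete), the constant
   family `A.X ⊗ S₂ → S₂` (smooth of relative dimension `2M` and proper by base change, every fibre
   `≅ A.X`: `eFib`, via `pullbackLeftPullbackSndIso` and `pullback_fst_iso_of_right_iso`), and the test
   class `W = collapse^* c` where `collapse : (A × S₂)(ℂ) → A(ℂ)` is the projection on the sheet over `p₁`
   and the constant map to the origin on the sheet over `p₀` (continuous because the sheets are clopen);
   `W|_{p₁} = eFib^* c` (`testClass_fiber_p₁`), `W|_{p₀} = 0` (`testClass_fiber_p₀`: a constant map factors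
   through a point and `H^{2M}(pt) = 0`, tree `isZero_singularCohomology_of_subsingleton'`), so `W` is
   fibrewise rational `(M,M)` (zero / iso-transport), anchored at `p₀`, and the weakened rung returns
   `c ∈ algebraicClasses A.X M`. Only `Smooth S₂.hom` (true: `ℂ × ℂ` is étale over `ℂ`) is not
   re-verified, which is why `RungWithoutIrreducible` drops it together with irreducibility.
6. LITERATURE (read this session, held texts): Charles–Schnell arXiv:1101.3647 §3.1 pp. 13–15 (Conj. 30 =
   Grothendieck 1966 fn. 13; Prop. 34; Cor. 35 HC ⇒ VHC; "Very little seems to be known about the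
   variational Hodge conjecture, see however [Blo]"; Thm. 36 Principle B — the absolute-Hodge version of the
   crux is a THEOREM, and on abelian fibres every Hodge class is absolute (Deligne 1982, book Thm. 11.5.1),
   so the absolute shadow of the crux holds unconditionally; remark after Thm. 36: standard conjectures ⇒
   VHC [An]); Markman arXiv:2502.03415 p. 7 Cor. 1.6.1 (HC for abelian fourfolds) and §1.2 (secant
   construction proper for `n ≥ 4`: no transport engine in fibre dimension ≥ 8 — a PROVABILITY obstruction,
   not a falsity handle). `lit search` was degraded (searchd rc 75 ×2); `ledger negatives`: see NOTES.
7. TARGETS: none yet (`payload.targets = []`, no line picked); §6 reserved for stub kills on re-arm.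

Nothing in this file asserts a Theses decl except under a hypothesis; the crux is untouched.
-/

noncomputable section

set_option linter.dupNamespace false

namespace Summit.HodgeConjecture.HodgeConjecture.Cruxes.WeilVariationalHodge.Disproof

open CategoryTheory
open Literature.AlgebraicGeometry.Motives Literature.AlgebraicGeometry.HodgeTheory
open Summit.HodgeConjecture.HodgeConjecture.Theses

/-! ## §0 Readback: the pieces of the crux, named; the crux re-read by `Iff.rfl` -/

/-- Fibrewise hypothesis on the global class `W ∈ H^{2M}(𝒳(ℂ); ℂ)`: every fibre restriction is a
rational class of Hodge type `(M, M)`. -/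
def FibrewiseRationalHodge {𝒳 S : SchemeOver ℂ} (f : 𝒳 ⟶ S) (M : ℕ)
    (W : complexBetti 𝒳 (2 * M)) : Prop :=
  ∀ s : ComplexPoints S, IsRationalClass (complexBetti.map (fiberι f s) (2 * M) W) ∧
    IsOfHodgeType (2 * M) (fiberOver f s) (2 * M) M M (complexBetti.map (fiberι f s) (2 * M) W)

/-- The Weil-type fibre hypothesis: every fibre is isomorphic (as a `ℂ`-scheme) to an abelian
`2M`-fold carrying an endomorphism `φ'` with `φ' ∘ φ' = -p`. -/
def WeilFibres {𝒳 S : SchemeOver ℂ} (f : 𝒳 ⟶ S) (p M : ℕ) : Prop :=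
  ∀ s : ComplexPoints S, ∃ (A' : AbelianVariety ℂ) (φ' : A' ⟶ A'), A'.dim = (2 * M) ∧
    φ' ≫ φ' = -((p : ℤ) • 𝟙 A') ∧ Nonempty (A'.X ≅ fiberOver f s)

/-- `W|_{𝒳_s}` is algebraic (lies in `N^M H^{2M}(𝒳_s(ℂ); ℂ)`). -/
def AlgebraicAt {𝒳 S : SchemeOver ℂ} (f : 𝒳 ⟶ S) (M : ℕ) (W : complexBetti 𝒳 (2 * M))
    (s : ComplexPoints S) : Prop :=
  complexBetti.map (fiberι f s) (2 * M) W ∈ algebraicClasses (fiberOver f s) M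

/-- The rung `(p, M)` of the crux: variational Hodge for global classes of fibrewise type `(M,M)`
along smooth projective families of relative dimension `2M` with Weil fibres, over a smooth
irreducible base. -/
def Rung (p M : ℕ) : Prop :=
  ∀ ⦃𝒳 S : SchemeOver ℂ⦄ (f : 𝒳 ⟶ S), IsSmoothProjectiveFamily f (2 * M) → IrreducibleSpace S.left →
    AlgebraicGeometry.Smooth S.hom → ∀ W : complexBetti 𝒳 (2 * M), FibrewiseRationalHodge f M W →
      WeilFibres f p M → (∃ s₀, AlgebraicAt f M W s₀) → ∀ s, AlgebraicAt f M W s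

/-- READBACK: the crux is, definitionally, "`Rung p M` for every prime `p ≡ 3 (4)`, `p ≥ 7`, and
every `M ≥ 1`". -/
theorem weilVariationalHodge_iff :
    HeckePrymWeil.WeilVariationalHodge ↔
      ∀ p : ℕ, p.Prime → p % 4 = 3 → 7 ≤ p → ∀ M : ℕ, 1 ≤ M → Rung p M :=
  Iff.rfl

/-! ## §1 The crux is dominated by the summit: any kill is a disproof of the Hodge conjecture -/

/-- The fragment of the Hodge conjecture that decides every rung: rational `(M,M)`-classes on smooth
projective `2M`-folds are algebraic. -/
def FibreHC (M : ℕ) : Prop :=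
  ∀ ⦃X : SchemeOver ℂ⦄, IsSmoothProjective (2 * M) X → ∀ c : complexBetti X (2 * M),
    IsRationalClass c → IsOfHodgeType (2 * M) X (2 * M) M M c → c ∈ algebraicClasses X M

/-- `HodgeConjecture → FibreHC M` (degree-`2M` part of the summit on `2M`-folds). -/
theorem fibreHC_of_hodgeConjecture (h : _root_.HodgeConjecture) (M : ℕ) : FibreHC M :=
  fun _ hX c hc hh => (h hX).2 M c hc hh

/-- `FibreHC M → Rung p M` for EVERY `p`: the proof uses only that the fibre `𝒳_s` is smooth
projective (a field of `IsSmoothProjectiveFamily`) and that `W|_{𝒳_s}` is rational of type `(M,M)`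
AT `s`; irreducibility and smoothness of `S`, the Weil fibres, the prime `p` and the anchor `s₀` are
not touched. -/
theorem rung_of_fibreHC {M : ℕ} (h : FibreHC M) (p : ℕ) : Rung p M :=
  fun _ _ _ hf _ _ _ hW _ _ s => h (hf.isSmoothProjective s) _ (hW s).1 (hW s).2

/-- **`HodgeConjecture → WeilVariationalHodge`.** -/
theorem weilVariationalHodge_of_hodgeConjecture (h : _root_.HodgeConjecture) :
    HeckePrymWeil.WeilVariationalHodge :=
  fun p _ _ _ M _ => rung_of_fibreHC (fibreHC_of_hodgeConjecture h M) p

/-- **Contrapositive: a refutation of the crux refutes the Clay problem.** -/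
theorem not_hodgeConjecture_of_not_weilVariationalHodge
    (h : ¬ HeckePrymWeil.WeilVariationalHodge) : ¬ _root_.HodgeConjecture :=
  fun hHC => h (weilVariationalHodge_of_hodgeConjecture hHC)

/-- The crux is the Weil-fibre instance of route AnchorTransport's crux `VariationalHodge`
(stmt-HodgeConjecture-1076): `n := 2M`, `p := M`, the Weil-fibre hypothesis discarded. -/
theorem weilVariationalHodge_of_variationalHodge (hV : AnchorTransport.VariationalHodge) :
    HeckePrymWeil.WeilVariationalHodge :=
  fun _ _ _ _ M _ _ _ f hf hirr hsm W hW _ hs₀ s => hV f hf hirr hsm M W hW hs₀ s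

/-- KILL PROPAGATION across routes: a refutation of this crux refutes `AnchorTransport.VariationalHodge`. -/
theorem not_variationalHodge_of_not_weilVariationalHodge
    (h : ¬ HeckePrymWeil.WeilVariationalHodge) : ¬ AnchorTransport.VariationalHodge :=
  fun hV => h (weilVariationalHodge_of_variationalHodge hV)

/-- The two routes file the SAME iso-invariance support item (stmt-HodgeConjecture-1078). -/
example : AnchorTransport.IsoInvariance = HeckePrymWeil.IsoInvariance := rfl

/-! ## §2 Sharper upper bound: pointwise Hodge on abelian `2M`-folds with `√-p` suffices -/

/-- `SectorHC p M`: EVERY rational `(M,M)`-class on EVERY complex abelian `2M`-fold carrying `φ` with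
`φ ∘ φ = -p` is algebraic — all Hodge classes of such abelian varieties, NOT only the Weil eigen-span
`Eig((𝟙+φ)^*, (1±i√p)^{2M})` of the route's rung predicate. -/
def SectorHC (p M : ℕ) : Prop :=
  ∀ (A : AbelianVariety ℂ) (φ : A ⟶ A), A.dim = 2 * M → φ ≫ φ = -((p : ℤ) • 𝟙 A) →
    ∀ c : complexBetti A.X (2 * M), IsRationalClass c → IsOfHodgeType (2 * M) A.X (2 * M) M M c →
      c ∈ algebraicClasses A.X M

/-- `FibreHC M → SectorHC p M` (abelian varieties are smooth projective: the tree's proved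
`AbelianVariety.isSmoothProjective_holds`). -/
theorem sectorHC_of_fibreHC {M : ℕ} (h : FibreHC M) (p : ℕ) : SectorHC p M := by
  intro A _ hdim _ c hrat hhodge
  have hsp : IsSmoothProjective (2 * M) A.X := by
    have h' := (AbelianVariety.isSmoothProjective_holds (A := A))
    rw [AbelianVariety.isSmoothProjective, hdim] at h'
    exact h'
  exact h hsp c hrat hhodge

/-- **`SectorHC p M → Rung p M`**: transport the fibre class to the abelian variety `A'` along the
given iso `e : A'.X ≅ 𝒳_s` (rationality: `IsRationalClass.map`; Hodge type: `IsOfHodgeType.map_of_iso`;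
algebraicity back along `e⁻¹`: `mem_algebraicClasses_map_of_iso`, all PROVED in the tree), apply the
pointwise statement on `A'`, and return. Irreducibility/smoothness of `S` and the anchor `s₀` are,
again, not used: the crux's only use of its family structure is to be weaker than this. -/
theorem rung_of_sectorHC {p M : ℕ} (h : SectorHC p M) : Rung p M := by
  intro 𝒳 S f hf _ _ W hW hA _ s
  obtain ⟨A', φ', hdim, hφ, ⟨e⟩⟩ := hA s
  have hsp : IsSmoothProjective (2 * M) A'.X := by
    have h' := (AbelianVariety.isSmoothProjective_holds (A := A'))
    rw [AbelianVariety.isSmoothProjective, hdim] at h'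
    exact h'
  set c := complexBetti.map (fiberι f s) (2 * M) W with hc
  have hrat : IsRationalClass (complexBetti.map e.hom (2 * M) c) := (hW s).1.map _
  have hhodge : IsOfHodgeType (2 * M) A'.X (2 * M) M M (complexBetti.map e.hom (2 * M) c) :=
    (hW s).2.map_of_iso e
  have halg : complexBetti.map e.hom (2 * M) c ∈ algebraicClasses A'.X M :=
    h A' φ' hdim hφ _ hrat hhodge
  have back := mem_algebraicClasses_map_of_iso hsp (hf.isSmoothProjective s) e.symm halg
  have hid : complexBetti.map e.symm.hom (2 * M) (complexBetti.map e.hom (2 * M) c) = c :=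
    map_hom_map_inv_apply e.symm (2 * M) c
  rw [hid] at back
  exact back

/-- Hence `(∀ p M in range, SectorHC p M) → WeilVariationalHodge`. -/
theorem weilVariationalHodge_of_sectorHC
    (h : ∀ p : ℕ, p.Prime → p % 4 = 3 → 7 ≤ p → ∀ M : ℕ, 1 ≤ M → SectorHC p M) :
    HeckePrymWeil.WeilVariationalHodge :=
  fun p hp h4 h7 M hM => rung_of_sectorHC (h p hp h4 h7 M hM)

/-- **Second, HC-free upper bound (André 1996):** the Lefschetz standard conjecture `B` for all smooth
projective complex varieties implies `SectorHC p M` for all `p, M`, granted André's two printed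
theorems (tree named facts): Hodge classes on abelian varieties are motivated (Thm. 0.6.2), and under
`B` motivated classes are algebraic (§2.1). So a kill of the crux refutes `B` (modulo print). -/
theorem sectorHC_of_standardConjectureB
    (hB : ∀ (d : ℕ) (Z : SchemeOver ℂ) (η : complexBetti Z 2), IsSmoothProjective d Z →
      StandardConjectureBStar d Z η)
    (hA1 : Andre1996_motivatedClasses_le_algebraicClasses_of_standardConjectureB)
    (hA2 : Andre1996_hodgeClasses_abelianVariety_motivated) (p M : ℕ) : SectorHC p M := by
  intro A _ hdim _ c hrat hhodge
  have hsp : IsSmoothProjective A.dim A.X := AbelianVariety.isSmoothProjective_holds (A := A)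
  have hhodge' : IsOfHodgeType A.dim A.X (2 * M) M M c := by rw [hdim]; exact hhodge
  have hmot : c ∈ motivatedClasses A.dim A.X M := hA2 A hsp M c hrat hhodge'
  exact hA1 hB hsp M hmot

/-- Contrapositive packaging of §1–§2: what a refutation of the crux would deliver. -/
theorem consequences_of_not_weilVariationalHodge (h : ¬ HeckePrymWeil.WeilVariationalHodge) :
    ¬ _root_.HodgeConjecture ∧ ¬ AnchorTransport.VariationalHodge ∧
      (∃ p M : ℕ, p.Prime ∧ p % 4 = 3 ∧ 7 ≤ p ∧ 1 ≤ M ∧ ¬ SectorHC p M) ∧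
      (Andre1996_motivatedClasses_le_algebraicClasses_of_standardConjectureB →
        Andre1996_hodgeClasses_abelianVariety_motivated →
          ¬ ∀ (d : ℕ) (Z : SchemeOver ℂ) (η : complexBetti Z 2), IsSmoothProjective d Z →
              StandardConjectureBStar d Z η) := by
  refine ⟨not_hodgeConjecture_of_not_weilVariationalHodge h,
    not_variationalHodge_of_not_weilVariationalHodge h, ?_, ?_⟩
  · by_contra hne
    apply h
    apply weilVariationalHodge_of_sectorHC
    intro p hp h4 h7 M hM
    by_contra hS
    exact hne ⟨p, M, hp, h4, h7, hM, hS⟩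
  · intro hA1 hA2 hB
    exact h (weilVariationalHodge_of_sectorHC fun p _ _ _ M _ =>
      sectorHC_of_standardConjectureB hB hA1 hA2 p M)

/-! ## §3 Load-bearing analysis: which hypotheses matter for TRUTH (none refutable), which for PROOF -/

/-- `1 ≤ M` is decoration: the rung `M = 0` is TRUE outright (`N⁰ H⁰ = H⁰`, the tree's
`algebraicClasses_zero`). -/
theorem rung_zero (p : ℕ) : Rung p 0 := by
  intro 𝒳 S f _ _ _ W _ _ _ s
  change _ ∈ algebraicClasses (fiberOver f s) 0
  rw [algebraicClasses_zero]
  exact Submodule.mem_top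

/-- So the crux is equivalent to its `M ≥ 0` form. -/
theorem weilVariationalHodge_iff_withZero :
    HeckePrymWeil.WeilVariationalHodge ↔
      ∀ p : ℕ, p.Prime → p % 4 = 3 → 7 ≤ p → ∀ M : ℕ, Rung p M := by
  rw [weilVariationalHodge_iff]
  refine ⟨fun h p hp h4 h7 M => ?_, fun h p hp h4 h7 M _ => h p hp h4 h7 M⟩
  rcases Nat.eq_zero_or_pos M with rfl | hM
  · exact rung_zero p
  · exact h p hp h4 h7 M hM

/-- KNOWN RUNG `M = 1` (abelian-surface fibres, `(1,1)`-classes): a theorem in print — Lefschetz's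
theorem on `(1,1)`-classes (tree named fact `lefschetzOneOne_rational`, Voisin I Thm. 11.30) — for
every `p`, with no use of the family. -/
theorem rung_one_of_lefschetz (hL : lefschetzOneOne_rational) (p : ℕ) : Rung p 1 :=
  rung_of_fibreHC (fun _ hX c hc hh => hL hX c hc hh) p

/-- KNOWN RUNG `M = 2` (abelian-fourfold fibres): "The Hodge conjecture holds for abelian fourfolds"
(Markman, arXiv:2502.03415 Cor. 1.6.1; held text p. 7), spelled exactly as the hypothesis of the tree's
`Markman2025_weilClasses_algebraic_abelianFourfold_of_hodgeConjectureFor_abelianFourfold`, gives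
`SectorHC p 2` and hence `Rung p 2` for every `p` (through the iso-transport of `rung_of_sectorHC`). -/
theorem rung_two_of_hodgeConjecture_abelianFourfolds
    (h : ∀ A : AbelianVariety ℂ, A.dim = 2 * 2 → IsSmoothProjective (2 * 2) A.X →
      HodgeConjectureFor (2 * 2) A.X) (p : ℕ) : Rung p 2 := by
  refine rung_of_sectorHC fun A _ hdim _ c hrat hhodge => ?_
  have hsp : IsSmoothProjective (2 * 2) A.X := by
    have h' := (AbelianVariety.isSmoothProjective_holds (A := A))
    rw [AbelianVariety.isSmoothProjective, hdim] at h'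
    exact h'
  exact (h A hdim hsp).2 2 c hrat hhodge

/-- The `p`-conditions are decoration for truth: `Rung p M` for ALL `p` follows from `FibreHC M`
(`rung_of_fibreHC`); in particular the crux with `p.Prime → p % 4 = 3 → 7 ≤ p` deleted is still a
consequence of the Hodge conjecture. -/
theorem rung_all_p_of_hodgeConjecture (h : _root_.HodgeConjecture) (p M : ℕ) : Rung p M :=
  rung_of_fibreHC (fibreHC_of_hodgeConjecture h M) p

/-- The crux with EVERY provability hypothesis stripped (no irreducibility, no smooth base, no Weil
fibres, no anchor `s₀`, all `p`, all `M`): fibrewise Hodge for restricted global classes. -/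
def Stripped : Prop :=
  ∀ (M : ℕ) ⦃𝒳 S : SchemeOver ℂ⦄ (f : 𝒳 ⟶ S), IsSmoothProjectiveFamily f (2 * M) →
    ∀ (W : complexBetti 𝒳 (2 * M)) (s : ComplexPoints S),
      IsRationalClass (complexBetti.map (fiberι f s) (2 * M) W) →
      IsOfHodgeType (2 * M) (fiberOver f s) (2 * M) M M (complexBetti.map (fiberι f s) (2 * M) W) →
        AlgebraicAt f M W s

/-- `HodgeConjecture → Stripped`. -/
theorem stripped_of_hodgeConjecture (h : _root_.HodgeConjecture) : Stripped :=
  fun M _ _ _ hf _ s hr hh => (h (hf.isSmoothProjective s)).2 M _ hr hh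

/-- `Stripped → WeilVariationalHodge`: every hypothesis the crux adds to `Stripped` is scaffolding
for a PROOF (transport needs a connected base and an anchor), not a condition for TRUTH. -/
theorem weilVariationalHodge_of_stripped (h : Stripped) : HeckePrymWeil.WeilVariationalHodge :=
  fun _ _ _ _ M _ _ _ f hf _ _ W hW _ _ s => h M f hf W s (hW s).1 (hW s).2

/-- WITHIN THE ROUTE a kill does NOT propagate to the target: `LadderGlue` (stmt-14499) becomes
vacuously true and `HodgeWeilLadder` is untouched (the ladder speaks of Weil-span classes only and
implies nothing about transport). Recorded as the vacuous glue. (Work-file only: positive Theses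
conclusion under a hypothesis.) -/
theorem ladderGlue_of_not_weilVariationalHodge (h : ¬ HeckePrymWeil.WeilVariationalHodge) :
    HeckePrymWeil.LadderGlue :=
  fun _ hV => absurd hV h

/-! ## §4 Junk / small models: none constructible (see module docstring item 4) -/

/-- The only abelian variety the tree can build today is the point; it is excluded from every rung by
`A'.dim = 2 * M` with `1 ≤ M` (and `M = 0` is true anyway, `rung_zero`). Recorded as the arithmetic. -/
theorem dim_zero_excluded {M : ℕ} (hM : 1 ≤ M) : (0 : ℕ) ≠ 2 * M := by omega

/-! ## §5 Near-misses as statements (paper proofs in docstrings; no `sorry`) -/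

/-- The rung with `IrreducibleSpace S.left` (and `Smooth S.hom`) DROPPED. -/
def RungWithoutIrreducible (p M : ℕ) : Prop :=
  ∀ ⦃𝒳 S : SchemeOver ℂ⦄ (f : 𝒳 ⟶ S), IsSmoothProjectiveFamily f (2 * M) →
    ∀ W : complexBetti 𝒳 (2 * M), FibrewiseRationalHodge f M W →
      WeilFibres f p M → (∃ s₀, AlgebraicAt f M W s₀) → ∀ s, AlgebraicAt f M W s

/-- Trivial direction, kernel-checked: the weakened rung still follows from the pointwise statement. -/
theorem rungWithoutIrreducible_of_sectorHC {p M : ℕ} (h : SectorHC p M) : RungWithoutIrreducible p M := by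
  intro 𝒳 S f hf W hW hA _ s
  obtain ⟨A', φ', hdim, hφ, ⟨e⟩⟩ := hA s
  have hsp : IsSmoothProjective (2 * M) A'.X := by
    have h' := (AbelianVariety.isSmoothProjective_holds (A := A'))
    rw [AbelianVariety.isSmoothProjective, hdim] at h'
    exact h'
  have halg : complexBetti.map e.hom (2 * M) (complexBetti.map (fiberι f s) (2 * M) W) ∈
      algebraicClasses A'.X M :=
    h A' φ' hdim hφ _ ((hW s).1.map _) ((hW s).2.map_of_iso e)
  have back := mem_algebraicClasses_map_of_iso hsp (hf.isSmoothProjective s) e.symm halg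
  have hid : complexBetti.map e.symm.hom (2 * M)
      (complexBetti.map e.hom (2 * M) (complexBetti.map (fiberι f s) (2 * M) W)) =
        complexBetti.map (fiberι f s) (2 * M) W :=
    map_hom_map_inv_apply e.symm (2 * M) _
  rw [hid] at back
  exact back

/-! ### §5b The two-point test family (kernel-checked converse) -/

namespace TwoPoint

open CategoryTheory.Limits AlgebraicGeometry MonoidalCategory
open Literature.AlgebraicTopology.SingularHomology

/-- The two-point base `Spec (ℂ × ℂ)` over `ℂ`. -/
abbrev S₂ : SchemeOver ℂ := specOver ℂ (ℂ × ℂ)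

/-- The complex point of `S₂` attached to a `ℂ`-algebra map `ℂ × ℂ → ℂ`. -/
def ptOf (ψ : (ℂ × ℂ) →ₐ[ℂ] ℂ) : ComplexPoints S₂ :=
  Over.homMk (Spec.map (CommRingCat.ofHom ψ.toRingHom)) (by
    change Spec.map _ ≫ Spec.map _ = Spec.map _
    rw [← Spec.map_comp, ← CommRingCat.ofHom_comp]
    congr 2
    ext x
    simp)

/-- The point `(a, b) ↦ a`. -/
def p₀ : ComplexPoints S₂ := ptOf (AlgHom.fst ℂ ℂ ℂ)

/-- The point `(a, b) ↦ b`. -/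
def p₁ : ComplexPoints S₂ := ptOf (AlgHom.snd ℂ ℂ ℂ)

theorem p₀_left : p₀.left = Spec.map (CommRingCat.ofHom (RingHom.fst ℂ ℂ)) := rfl
theorem p₁_left : p₁.left = Spec.map (CommRingCat.ofHom (RingHom.snd ℂ ℂ)) := rfl

theorem specOver_self_hom_eq : (specOver ℂ ℂ).hom = 𝟙 (Spec (CommRingCat.of ℂ)) := by
  simp only [specOver, Over.mk_hom, Algebra.algebraMap_self, CommRingCat.ofHom_id, Spec.map_id]

theorem p₀_ne_p₁ : p₀ ≠ p₁ := by
  intro h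
  have h1 : p₀.left = p₁.left := congrArg CommaMorphism.left h
  rw [p₀_left, p₁_left] at h1
  have h2 := Spec.map_injective h1
  have h3 := congrArg (fun g : CommRingCat.of (ℂ × ℂ) ⟶ CommRingCat.of ℂ => g.hom (1, 0)) h2
  simp at h3

/-- Every complex point of `Spec (ℂ × ℂ)` is `p₀` or `p₁`. -/
theorem pt_cases (s : ComplexPoints S₂) : s = p₀ ∨ s = p₁ := by
  obtain ⟨φ, hφ⟩ := Spec.map_surjective s.left
  have hw : s.left ≫ S₂.hom = (specOver ℂ ℂ).hom := Over.w s
  have hcomp : CommRingCat.ofHom (algebraMap ℂ (ℂ × ℂ)) ≫ φ = CommRingCat.ofHom (algebraMap ℂ ℂ) := by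
    apply Spec.map_injective
    rw [Spec.map_comp, hφ]
    exact hw
  have hdiag : ∀ a : ℂ, φ.hom (a, a) = a := by
    intro a
    have := congrArg (fun g : CommRingCat.of ℂ ⟶ CommRingCat.of ℂ => g.hom a) hcomp
    simpa [Prod.algebraMap_apply] using this
  have he : φ.hom (1, 0) * (φ.hom (1, 0) - 1) = 0 := by
    have h := map_mul φ.hom ((1 : ℂ), (0 : ℂ)) (1, 0)
    simp only [Prod.mk_mul_mk, mul_one, mul_zero] at h
    linear_combination -h
  have hsum : φ.hom (1, 0) + φ.hom (0, 1) = 1 := by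
    rw [← map_add]
    simpa using hdiag 1
  have hlin : ∀ a b : ℂ, φ.hom (a, b) = a * φ.hom (1, 0) + b * φ.hom (0, 1) := by
    intro a b
    have h : ((a, b) : ℂ × ℂ) = (a, a) * (1, 0) + (b, b) * (0, 1) := by ext <;> simp
    rw [h, map_add, map_mul, map_mul, hdiag, hdiag]
  rcases mul_eq_zero.mp he with h0 | h1
  · -- φ (1,0) = 0 : φ = snd
    right
    have h01 : φ.hom (0, 1) = 1 := by rw [h0, zero_add] at hsum; exact hsum
    have hφ' : φ = CommRingCat.ofHom (RingHom.snd ℂ ℂ) := by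
      ext ⟨a, b⟩
      change φ.hom (a, b) = b
      rw [hlin, h0, h01]; ring
    apply Over.OverMorphism.ext
    rw [p₁_left, ← hφ', hφ]
  · -- φ (1,0) = 1 : φ = fst
    left
    have h10 : φ.hom (1, 0) = 1 := by linear_combination h1
    have h01 : φ.hom (0, 1) = 0 := by rw [h10] at hsum; linear_combination hsum
    have hφ' : φ = CommRingCat.ofHom (RingHom.fst ℂ ℂ) := by
      ext ⟨a, b⟩
      change φ.hom (a, b) = a
      rw [hlin, h10, h01]; ring
    apply Over.OverMorphism.ext
    rw [p₀_left, ← hφ', hφ]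

instance : Finite (ComplexPoints S₂) :=
  Finite.of_surjective (fun b : Bool => if b then p₁ else p₀) (by
    intro s
    rcases pt_cases s with rfl | rfl
    exacts [⟨false, rfl⟩, ⟨true, rfl⟩])

instance : IsSeparated S₂.hom := by
  change IsSeparated (Spec.map _)
  infer_instance

instance : T2Space (ComplexPoints S₂) := ComplexPoints.t2Space_of_isSeparated S₂

instance : DiscreteTopology (ComplexPoints S₂) := inferInstance

/-! ### The constant family `A × S₂ → S₂` and its fibres -/

variable (X : SchemeOver ℂ)

/-- The constant family. -/
abbrev fam : X ⊗ S₂ ⟶ S₂ := CartesianMonoidalCategory.snd X S₂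

theorem isIso_fiberι_fst_left (s : ComplexPoints S₂) :
    IsIso (fiberι (fam X) s ≫ CartesianMonoidalCategory.fst X S₂).left := by
  have hg : IsIso (s.left ≫ S₂.hom) := by
    rw [Over.w s, specOver_self_hom_eq]
    exact IsIso.id _
  have key : (fiberι (fam X) s ≫ CartesianMonoidalCategory.fst X S₂).left =
      (pullbackLeftPullbackSndIso X.hom S₂.hom s.left).hom ≫ pullback.fst X.hom (s.left ≫ S₂.hom) := by
    rw [pullbackLeftPullbackSndIso_hom_fst]
    rfl
  have h2 : IsIso (pullback.fst X.hom (s.left ≫ S₂.hom)) := by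
    haveI := hg
    exact pullback_fst_iso_of_right_iso X.hom (s.left ≫ S₂.hom)
  rw [key]
  haveI := h2
  exact IsIso.comp_isIso

theorem isIso_fiberι_fst (s : ComplexPoints S₂) :
    IsIso (fiberι (fam X) s ≫ CartesianMonoidalCategory.fst X S₂) := by
  have h : IsIso ((Over.forget _).map (fiberι (fam X) s ≫ CartesianMonoidalCategory.fst X S₂)) := by
    change IsIso (fiberι (fam X) s ≫ CartesianMonoidalCategory.fst X S₂).left
    exact isIso_fiberι_fst_left X s
  exact isIso_of_reflects_iso (fiberι (fam X) s ≫ CartesianMonoidalCategory.fst X S₂) (Over.forget _)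

/-- The fibre of the constant family over any complex point is `X`. -/
def eFib (s : ComplexPoints S₂) : fiberOver (fam X) s ≅ X :=
  haveI := isIso_fiberι_fst X s
  asIso (fiberι (fam X) s ≫ CartesianMonoidalCategory.fst X S₂)

theorem eFib_hom (s : ComplexPoints S₂) :
    (eFib X s).hom = fiberι (fam X) s ≫ CartesianMonoidalCategory.fst X S₂ := rfl

variable {X} in
theorem fam_isSmoothProjectiveFamily {n : ℕ} (hX : IsSmoothProjective n X) [IsProper X.hom] :
    IsSmoothProjectiveFamily (fam X) n := by
  refine ⟨?_, ?_, fun s => hX.of_iso (eFib X s).symm⟩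
  · change SmoothOfRelativeDimension n (pullback.snd X.hom S₂.hom)
    haveI := smoothOfRelativeDimension_isStableUnderBaseChange (n := n)
    exact MorphismProperty.pullback_snd (P := @SmoothOfRelativeDimension n) _ _
      hX.smoothOfRelativeDimension
  · change IsProper (pullback.snd X.hom S₂.hom)
    infer_instance

/-! ### The test class: `c` on the sheet over `p₁`, `0` on the sheet over `p₀` -/

open Classical in
/-- The collapse map `(X × S₂)(ℂ) → X(ℂ)`: the projection on the sheet over `p₁`, constant `a₀` on
the other sheet. -/
def collapse (a₀ : ComplexPoints X) : C(ComplexPoints (X ⊗ S₂), ComplexPoints X) where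
  toFun P := if AlgPoints.map (fam X) P = p₁ then AlgPoints.map (CartesianMonoidalCategory.fst X S₂) P else a₀
  continuous_toFun := by
    refine Continuous.if ?_ (AlgPoints.continuous_map _) continuous_const
    intro a ha
    have hclopen : IsClopen {P : ComplexPoints (X ⊗ S₂) | AlgPoints.map (fam X) P = p₁} :=
      (isClopen_discrete ({p₁} : Set (ComplexPoints S₂))).preimage (AlgPoints.continuous_map _)
    rw [hclopen.frontier_eq] at ha
    exact absurd ha (Set.notMem_empty a)

open Classical in
theorem collapse_apply (a₀ : ComplexPoints X) (P : ComplexPoints (X ⊗ S₂)) :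
    collapse X a₀ P =
      if AlgPoints.map (fam X) P = p₁ then AlgPoints.map (CartesianMonoidalCategory.fst X S₂) P else a₀ :=
  rfl

/-- On the sheet over `p₁` the collapse map is the fibre identification `eFib`. -/
theorem collapse_comp_fiberι_p₁ (a₀ : ComplexPoints X) :
    (collapse X a₀).comp (AlgPoints.mapContinuous (L := ℂ) (fiberι (fam X) p₁)) =
      AlgPoints.mapContinuous (L := ℂ) (eFib X p₁).hom := by
  ext Q : 1
  change collapse X a₀ (AlgPoints.map (fiberι (fam X) p₁) Q) = AlgPoints.map (eFib X p₁).hom Q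
  rw [collapse_apply, if_pos (AlgPoints.map_map_fiberι _ _ _), eFib_hom, AlgPoints.map_comp_apply]

/-- On the sheet over `p₀` the collapse map is constant. -/
theorem collapse_comp_fiberι_p₀ (a₀ : ComplexPoints X) :
    (collapse X a₀).comp (AlgPoints.mapContinuous (L := ℂ) (fiberι (fam X) p₀)) =
      ContinuousMap.const _ a₀ := by
  ext Q : 1
  change collapse X a₀ (AlgPoints.map (fiberι (fam X) p₀) Q) = a₀
  rw [collapse_apply, if_neg]
  rw [AlgPoints.map_map_fiberι]
  exact p₀_ne_p₁

/-- Pull-back along a constant map kills positive-degree classes (it factors through a point). -/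
theorem map_const_eq_zero {Y Z : Type} [TopologicalSpace Y] [TopologicalSpace Z] (z : Z) {k : ℕ}
    (hk : k ≠ 0) (c : singularCohomology ℂ ℂ Z k) :
    singularCohomology.map ℂ ℂ (ContinuousMap.const Y z) k c = 0 := by
  have hfac : (ContinuousMap.const Y z) =
      (ContinuousMap.const PUnit.{1} z).comp (ContinuousMap.const Y PUnit.unit) := by
    ext; rfl
  rw [hfac, singularCohomology.map_comp, ModuleCat.comp_apply]
  haveI := ModuleCat.subsingleton_of_isZero
    (singularCochainComplex.isZero_singularCohomology_of_subsingleton' (R := ℂ) (M := ℂ)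
      (X := PUnit.{1}) hk)
  rw [Subsingleton.elim (singularCohomology.map ℂ ℂ (ContinuousMap.const PUnit.{1} z) k c) 0, map_zero]

variable {X}

/-- The test class `W = collapse^* c` on the total space. -/
def testClass (a₀ : ComplexPoints X) {k : ℕ} (c : complexBetti X k) : complexBetti (X ⊗ S₂) k :=
  singularCohomology.map ℂ ℂ (collapse X a₀) k c

theorem testClass_fiber_p₁ (a₀ : ComplexPoints X) {k : ℕ} (c : complexBetti X k) :
    complexBetti.map (fiberι (fam X) p₁) k (testClass a₀ c) = complexBetti.map (eFib X p₁).hom k c := by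
  change (singularCohomology.map ℂ ℂ (collapse X a₀) k ≫
      singularCohomology.map ℂ ℂ (AlgPoints.mapContinuous (L := ℂ) (fiberι (fam X) p₁)) k) c = _
  rw [← singularCohomology.map_comp, collapse_comp_fiberι_p₁]

theorem testClass_fiber_p₀ (a₀ : ComplexPoints X) {k : ℕ} (hk : k ≠ 0) (c : complexBetti X k) :
    complexBetti.map (fiberι (fam X) p₀) k (testClass a₀ c) = 0 := by
  change (singularCohomology.map ℂ ℂ (collapse X a₀) k ≫
      singularCohomology.map ℂ ℂ (AlgPoints.mapContinuous (L := ℂ) (fiberι (fam X) p₀)) k) c = _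
  rw [← singularCohomology.map_comp, collapse_comp_fiberι_p₀]
  exact map_const_eq_zero a₀ hk c


end TwoPoint

open TwoPoint MonoidalCategory in
/-- **Irreducibility of the base is exactly what separates the crux from pointwise Hodge on the
sector**: with `IrreducibleSpace S.left` (and `Smooth S.hom`) dropped, the rung `(p, M)` implies
`SectorHC p M` — test it on the constant family `A × Spec (ℂ × ℂ) → Spec (ℂ × ℂ)` with the class that
is `c` on one sheet and `0` on the other. -/
theorem sectorHC_of_rungWithoutIrreducible {p M : ℕ} (h : RungWithoutIrreducible p M) :
    SectorHC p M := by
  intro A φ hdim hφ c hrat hhodge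
  rcases Nat.eq_zero_or_pos M with rfl | hM
  · rw [algebraicClasses_zero]
    exact Submodule.mem_top
  · have hsp : IsSmoothProjective (2 * M) A.X := by
      have h' := (AbelianVariety.isSmoothProjective_holds (A := A))
      rw [AbelianVariety.isSmoothProjective, hdim] at h'
      exact h'
    have h2M : 2 * M ≠ 0 := by omega
    -- the origin of `A` as a complex point
    let a₀ : ComplexPoints A.X := CartesianMonoidalCategory.toUnit _ ≫ (MonObj.one : 𝟙_ (SchemeOver ℂ) ⟶ A.X)
    have hf : IsSmoothProjectiveFamily (fam A.X) (2 * M) := fam_isSmoothProjectiveFamily hsp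
    have hW : FibrewiseRationalHodge (fam A.X) M (testClass a₀ c) := by
      intro s
      rcases pt_cases s with rfl | rfl
      · rw [testClass_fiber_p₀ a₀ h2M c]
        obtain ⟨Amod, _⟩ := hhodge
        exact ⟨IsRationalClass.zero, IsOfHodgeType.zero (Amod.ofIso (eFib A.X p₀)) _ _ _⟩
      · rw [testClass_fiber_p₁ a₀ c]
        exact ⟨hrat.map _, hhodge.map_of_iso (eFib A.X p₁)⟩
    have hA : WeilFibres (fam A.X) p M := fun s => ⟨A, φ, hdim, hφ, ⟨(eFib A.X s).symm⟩⟩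
    have hs₀ : ∃ s₀, AlgebraicAt (fam A.X) M (testClass a₀ c) s₀ := ⟨p₀, by
      change complexBetti.map (fiberι (fam A.X) p₀) (2 * M) (testClass a₀ c) ∈ _
      rw [testClass_fiber_p₀ a₀ h2M c]
      exact Submodule.zero_mem _⟩
    have key := h (fam A.X) hf (testClass a₀ c) hW hA hs₀ p₁
    change complexBetti.map (fiberι (fam A.X) p₁) (2 * M) (testClass a₀ c) ∈ _ at key
    rw [testClass_fiber_p₁ a₀ c] at key
    have back := mem_algebraicClasses_map_of_iso (hf.isSmoothProjective p₁) hsp (eFib A.X p₁).symm key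
    have hid : complexBetti.map (eFib A.X p₁).symm.hom (2 * M)
        (complexBetti.map (eFib A.X p₁).hom (2 * M) c) = c :=
      map_hom_map_inv_apply (eFib A.X p₁).symm (2 * M) c
    rw [hid] at back
    exact back


/-- Hence, kernel-checked: **the weakened rung is EQUIVALENT to pointwise Hodge on the sector.** -/
theorem rungWithoutIrreducible_iff_sectorHC (p M : ℕ) : RungWithoutIrreducible p M ↔ SectorHC p M :=
  ⟨sectorHC_of_rungWithoutIrreducible, rungWithoutIrreducible_of_sectorHC⟩

/-- And the crux itself sits in between: `SectorHC p M → Rung p M → ?`; the only hypothesis of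
`Rung` absent from `RungWithoutIrreducible` is `IrreducibleSpace S.left ∧ Smooth S.hom`, so modulo
the (paper-removable) smoothness of the base, irreducibility carries the WHOLE difference between
the crux and the Hodge conjecture on its own fibres. -/
theorem rung_of_rungWithoutIrreducible {p M : ℕ} (h : RungWithoutIrreducible p M) : Rung p M :=
  rung_of_sectorHC (sectorHC_of_rungWithoutIrreducible h)

end Summit.HodgeConjecture.HodgeConjecture.Cruxes.WeilVariationalHodge.Disproof

end
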